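import Literature.Topology.FourManifolds.LevelTorusFibrewise
import Literature.Topology.FourManifolds.SphereDiffeoLoops
import Literature.Topology.FourManifolds.GluingIsotopyProofs
import Literature.Topology.FourManifolds.GluingProofs
import Literature.Topology.FourManifolds.IsotopyProofs
import HarnessLib

/-!
# Fibred regluing of the genus-one splitting of `S⁴` gives `S⁴` — 4-sphere recognition from a
# splitting `X = (S² × D²) ∪ (B³ × S¹)` with fibred gluing map, WITHOUT Laudenbach–Poénaru

Topic `Literature/Topology/FourManifolds`; brick for the named fact
`Literature.Topology.FourManifolds.nonempty_diffeomorph_sphere_four_of_sblf_genus_one_noLefschetz`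
(Baykur–Kamada 2015, Lemma 11 with Cor. 14: a simply connected closed 4-manifold with a genus-one
simplified broken Lefschetz fibration without Lefschetz points is `S⁴`).  Everything in this file
is **proved**; no named fact is introduced.

## The statement

Let `S = W₀ ∪ V₀` be the genus-one splitting of the level 4-sphere
(`SphereFourGenusOneSplitting.lean`; `W₀ ≅ S² × D²`, `V₀ ≅ B³ × S¹`, common boundary the level
torus `L = S² × S¹`, gluing map `splitL`).  Let `X` be a closed smooth 4-manifold which is a
gluing `W₀ ∪_χ V₀` along some diffeomorphism `χ : ∂W₀ ≅ ∂V₀` which is **fibred over the round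
direction**: `χ` preserves the base coordinate `u = √2 (x₃, x₄) ∈ S¹` of the level torus, i.e.
in Gluck's coordinates `χ ∘ splitL⁻¹ (y, θ) = (g_θ y, θ)` for a loop `θ ↦ g_θ` in `Diff S²`.
**Then `X ≅ S⁴`** (`nonempty_diffeomorph_sphere_four_of_isBoundaryGluing_fibred`).

In the tree's reduction of Baykur–Kamada's Lemma 11
(`SimplifiedBrokenLefschetzSphereSideTube.lean`, §4) the sphere side of the fibration is `W₀`
and the gluing to the complementary tube is along a level of the height function, fibred by the
fibration over the round image circle; the present theorem removes the Laudenbach–Poénaru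
extension theorem (`exists_diffeomorph_comp_incl_eq`, which contains Cerf's `Γ₄ = 0`) from that
reduction whenever the complementary tube is identified with `V₀` *fibrewise over the round image
on its boundary* (`SimplifiedBrokenLefschetzFibredPolarTube.lean`).

## The proof (Gluck 1962, §5 and Cerf 1968, Appendice, Cor. 2)

Write `ψ = χ ∘ splitL⁻¹ = (y, θ) ↦ (g_θ y, θ)` (`fibrewiseFun_fibreMap`; §2 `glueSelf`,
`fibreLoop`).  The based loop `D_t = g_{κ t} ∘ g_0⁻¹` in `Diff S²` (`κ = stepFn`, flat at the
ends; §2 `basedLoop`) deforms through smooth based loops to a loop of rotations `A_t ∈ SO(3)` — the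
tree's `exists_loopHomotopy_frameLoop_two` (`SphereDiffeoLoops.lean`: `π₁(SO(3)) → π₁(Diff S²)`
is onto, Cerf 1968, Appendice §5, Corollaire 2 at `i = 1`, from Smale's theorem in families).
Hence the gluing map `χ` is smoothly isotopic to `(y, θ) ↦ (A_{κθ} g_0 y, θ)` (§4, Steps 1–2:
first the loop is reparametrised to be flat at the cut of the angle coordinate,
`contMDiff_reparamFamily`; then the deformation `𝒟_{σ,t}` of Cerf's corollary is applied
fibrewise, §3 `contMDiff_deformFamily`), which is the composite of
`(y, θ) ↦ (A_{κθ} y, θ)` — the restriction of the fibrewise linear diffeomorphism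
`(p, θ) ↦ (A_{κθ} p, θ)` of `V₀ ≅ B³ × S¹` (`rotDiffeo`; Gluck 1962, §5: this is why the Gluck
twist of an unknotted sphere is trivial) — and `(y, θ) ↦ (g_0 y, θ)` — the restriction of the
diffeomorphism `(y, w) ↦ (g_0 y, w)` of `W₀ ≅ S² × D²` (`constDiffeo`).  Gluing maps which are
isotopic, or which differ by diffeomorphisms extending over the pieces, give diffeomorphic
manifolds (Hirsch 1976, Ch. 8 §2, Thms. 2.1–2.3, the tree's `IsBoundaryGluing.of_isSmoothlyIsotopic`,
`.of_diffeomorph_right`, `.comp_diffeomorph`, `nonempty_diffeomorph_of_isBoundaryGluing_holds`);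
so `X ≅ W₀ ∪_{splitL} V₀ = S ≅ 𝕊⁴`.

## References

* H. Gluck, *The embedding of two-spheres in the four-sphere*, Trans. Amer. Math. Soc. 104
  (1962) 308–333, §5. [Gluck1962]
* J. Cerf, *Sur les difféomorphismes de la sphère de dimension trois (Γ₄ = 0)*, LNM 53 (1968),
  Appendice §5, Corollaire 2. [CerfDiffeoSphere1968]
* M. W. Hirsch, *Differential Topology*, GTM 33 (1976), Ch. 8 §2, Thms. 2.1–2.3. [HirschDT1976]
* R. İ. Baykur, S. Kamada, *Classification of broken Lefschetz fibrations with small fiber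
  genera*, J. Math. Soc. Japan 67 (2015), Lemma 11, Cor. 14. [BaykurKamada2015]
* D. Auroux, S. K. Donaldson, L. Katzarkov, *Singular Lefschetz pencils*, Geom. Topol. 9 (2005),
  §8.2, Example 1. [AurouxDonaldsonKatzarkov2005]
-/

open scoped Manifold ContDiff Topology RealInnerProductSpace
open Set Function Filter Metric Module

noncomputable section

namespace Literature.Topology.FourManifolds

/-- Local notation: `𝔼 n` is the model Euclidean space `EuclideanSpace ℝ (Fin n)`. -/
local notation "𝔼 " n:arg => EuclideanSpace ℝ (Fin n)

/-- Local notation: `𝕊 n` is the unit sphere in `EuclideanSpace ℝ (Fin (n + 1))`. -/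
local notation "𝕊 " n:arg => (Metric.sphere (0 : EuclideanSpace ℝ (Fin (n + 1))) 1)

attribute [local instance] fact_finrank_euclideanSpace_succ

namespace SphereFourSplitting

/-! ### §1 The level sphere is a gluing along any map `∂AV ∘ splitL ∘ ∂BW` -/

/-- The boundary datum of the equatorial tube `W₀`. [folklore] -/
abbrev bW : BoundaryData (𝓡∂ 4) EquatorTube (𝓡 3) := RegularSublevel.boundaryData isRegularLevel_tubeS

/-- The boundary datum of the polar tube `V₀`. [folklore] -/
abbrev bV : BoundaryData (𝓡∂ 4) PolarTube (𝓡 3) := RegularSublevel.boundaryData hPolar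

/-- **The level sphere is a gluing `W₀ ∪_χ₀ V₀` along every map of the form
`χ₀ = ∂AV ∘ splitL ∘ ∂BW`** with `AV` a self-diffeomorphism of `V₀` and `BW` one of `W₀`
(Hirsch 1976, Ch. 8 §2, Thm. 2.2: gluing maps differing by diffeomorphisms which extend over the
pieces give the same manifold). [cite: HirschDT1976, Ch. 8 §2, Thm. 2.2] -/
theorem isBoundaryGluing_levelSphere_comp (AV : PolarTube ≃ₘ⟮𝓡∂ 4, 𝓡∂ 4⟯ PolarTube)
    (BW : EquatorTube ≃ₘ⟮𝓡∂ 4, 𝓡∂ 4⟯ EquatorTube) :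
    IsBoundaryGluing bW bV
      ((bW.restrictDiffeomorph bW BW).trans (splitL.trans (bV.restrictDiffeomorph bV AV)))
      (𝓡 4) LevelSphere := by
  have h0 : IsBoundaryGluing bW bV splitL (𝓡 4) LevelSphere := isBoundaryGluing_levelSphere
  -- re-glue on the right through `AV`
  have h1 : IsBoundaryGluing bW bV (splitL.trans (bV.restrictDiffeomorph bV AV)) (𝓡 4) LevelSphere := by
    refine IsBoundaryGluing.of_diffeomorph_right (bN := bV) (bN' := bV)
      (φ := ⇑(splitL.trans (bV.restrictDiffeomorph bV AV))) h0 AV.symm fun z => ?_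
    rw [Diffeomorph.coe_trans, comp_apply, BoundaryData.incl_restrictDiffeomorph,
      Diffeomorph.symm_apply_apply]
  -- re-glue on the left through `BW`
  exact h1.comp_diffeomorph BW (bW.restrictDiffeomorph bW BW).toEquiv
    (fun z => (BoundaryData.incl_restrictDiffeomorph (b₂ := bW) BW z).symm) fun z => rfl

/-! ### §2 The fibre loop of a fibred gluing map and its two deformations -/

section FibreLoop

variable (ψ ψinv : LevelTorus → LevelTorus)

/-- The fibre maps of mutually inverse base-preserving self-maps of the level torus are mutually
inverse, fibre by fibre. [folklore] -/
theorem fibreMap_fibreMap (hψ : ∀ z, uS (ψ z) = uS z) (hinv : ∀ z, ψinv (ψ z) = z) (v : 𝕊 1) (w : 𝕊 2) :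
    fibreMap ψinv v (fibreMap ψ v w) = w := by
  have hP : P (yS (ψ (P (w, v))), v) = ψ (P (w, v)) := by
    apply ext_yS_uS
    · rw [yS_P]
    · rw [uS_P, hψ, uS_P]
  rw [fibreMap, fibreMap, hP, hinv, yS_P]

/-- **The fibre loop** `g t = g_{circlePt t}` of a self-map of the level torus: a `1`-periodic
family of self-maps of `S²`. [folklore] -/
def fibreLoop (t : ℝ) (w : 𝕊 2) : 𝕊 2 := fibreMap ψ (circlePt t) w

/-- The fibre loop is `1`-periodic. [folklore] -/
theorem fibreLoop_add_one (t : ℝ) : fibreLoop ψ (t + 1) = fibreLoop ψ t := by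
  funext w; rw [fibreLoop, fibreLoop, circlePt_add_one]

/-- The fibre loop of a smooth self-map is jointly smooth. [folklore] -/
theorem contMDiff_fibreLoop (hψ : ContMDiff (𝓡 3) (𝓡 3) ∞ ψ) :
    ContMDiff (𝓘(ℝ, ℝ).prod (𝓡 2)) (𝓡 2) ∞ (uncurry (fibreLoop ψ)) := by
  have h2 : ContMDiff (𝓘(ℝ, ℝ).prod (𝓡 2)) ((𝓡 1).prod (𝓡 2)) ∞
      fun p : ℝ × (𝕊 2) => (circlePt p.1, p.2) :=
    (contMDiff_circlePt.comp contMDiff_fst).prodMk contMDiff_snd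
  have h3 := (contMDiff_fibreMap hψ).comp h2
  exact h3

variable {ψ ψinv}

/-- Mutually inverse fibre loops. [folklore] -/
theorem fibreLoop_fibreLoop (hψ : ∀ z, uS (ψ z) = uS z) (hinv : ∀ z, ψinv (ψ z) = z) (t : ℝ) (w : 𝕊 2) :
    fibreLoop ψinv t (fibreLoop ψ t w) = w :=
  fibreMap_fibreMap ψ ψinv hψ hinv _ w

variable (ψ ψinv) in
/-- The stages `F_t = g_{κ t} ∘ g_0⁻¹` of the based loop (`κ = stepFn`). [folklore] -/
def loopF (t : ℝ) (w : 𝕊 2) : 𝕊 2 := fibreLoop ψ (stepFn t) (fibreLoop ψinv 0 w)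

variable (ψ ψinv) in
/-- The inverse stages `G_t = g_0 ∘ g_{κ t}⁻¹` of the based loop. [folklore] -/
def loopG (t : ℝ) (w : 𝕊 2) : 𝕊 2 := fibreLoop ψ 0 (fibreLoop ψinv (stepFn t) w)

variable (ψ ψinv) in
/-- The stages of the based loop are jointly smooth. [folklore] -/
theorem contMDiff_loopF (hψs : ContMDiff (𝓡 3) (𝓡 3) ∞ ψ) (hψinvs : ContMDiff (𝓡 3) (𝓡 3) ∞ ψinv) :
    ContMDiff (𝓘(ℝ, ℝ).prod (𝓡 2)) (𝓡 2) ∞ (uncurry (loopF ψ ψinv)) := by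
  have h1 := (contMDiff_fibreLoop ψinv hψinvs).comp
    (contMDiff_const (c := (0 : ℝ)).prodMk (contMDiff_snd (I := 𝓘(ℝ, ℝ)) (J := 𝓡 2) (M := ℝ) (N := 𝕊 2)))
  have h2 : ContMDiff (𝓘(ℝ, ℝ).prod (𝓡 2)) 𝓘(ℝ, ℝ) ∞ fun p : ℝ × (𝕊 2) => stepFn p.1 :=
    contDiff_stepFn.contMDiff.comp contMDiff_fst
  have h3 := (contMDiff_fibreLoop ψ hψs).comp (h2.prodMk h1)
  exact h3

variable (ψ ψinv) in
/-- The inverse stages of the based loop are jointly smooth. [folklore] -/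
theorem contMDiff_loopG (hψs : ContMDiff (𝓡 3) (𝓡 3) ∞ ψ) (hψinvs : ContMDiff (𝓡 3) (𝓡 3) ∞ ψinv) :
    ContMDiff (𝓘(ℝ, ℝ).prod (𝓡 2)) (𝓡 2) ∞ (uncurry (loopG ψ ψinv)) := by
  have h2 : ContMDiff (𝓘(ℝ, ℝ).prod (𝓡 2)) 𝓘(ℝ, ℝ) ∞ fun p : ℝ × (𝕊 2) => stepFn p.1 :=
    contDiff_stepFn.contMDiff.comp contMDiff_fst
  have h1 := (contMDiff_fibreLoop ψinv hψinvs).comp (h2.prodMk contMDiff_snd)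
  have h3 := (contMDiff_fibreLoop ψ hψs).comp ((contMDiff_const (c := (0 : ℝ))).prodMk h1)
  exact h3

/-- `G_t ∘ F_t = id`. [folklore] -/
theorem loopG_loopF (hψ : ∀ z, uS (ψ z) = uS z) (hψinv : ∀ z, uS (ψinv z) = uS z)
    (h₁ : ∀ z, ψinv (ψ z) = z) (h₂ : ∀ z, ψ (ψinv z) = z) (t : ℝ) (w : 𝕊 2) :
    loopG ψ ψinv t (loopF ψ ψinv t w) = w := by
  rw [loopG, loopF, fibreLoop_fibreLoop hψ h₁, fibreLoop_fibreLoop hψinv h₂]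

/-- `F_t ∘ G_t = id`. [folklore] -/
theorem loopF_loopG (hψ : ∀ z, uS (ψ z) = uS z) (hψinv : ∀ z, uS (ψinv z) = uS z)
    (h₁ : ∀ z, ψinv (ψ z) = z) (h₂ : ∀ z, ψ (ψinv z) = z) (t : ℝ) (w : 𝕊 2) :
    loopF ψ ψinv t (loopG ψ ψinv t w) = w := by
  rw [loopG, loopF, fibreLoop_fibreLoop hψ h₁, fibreLoop_fibreLoop hψinv h₂]

/-- `F_t = id` when `κ t = 0`, in particular for `t ≤ 0`. [folklore] -/
theorem loopF_of_le (hψinv : ∀ z, uS (ψinv z) = uS z) (h₂ : ∀ z, ψ (ψinv z) = z) {t : ℝ}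
    (ht : t ≤ 1 / 4) : loopF ψ ψinv t = id := by
  funext w
  rw [loopF, stepFn_of_le ht, fibreLoop_fibreLoop hψinv h₂, id]

/-- `F_t = id` for `t ≥ 3/4` (periodicity of the fibre loop). [folklore] -/
theorem loopF_of_ge (hψinv : ∀ z, uS (ψinv z) = uS z) (h₂ : ∀ z, ψ (ψinv z) = z) {t : ℝ}
    (ht : 3 / 4 ≤ t) : loopF ψ ψinv t = id := by
  funext w
  have h1 : fibreLoop ψ 1 = fibreLoop ψ 0 := by simpa using fibreLoop_add_one ψ 0
  rw [loopF, stepFn_of_ge ht, h1, fibreLoop_fibreLoop hψinv h₂, id]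

/-- **The based loop** `D_t = g_{κ t} ∘ g_0⁻¹` of the fibre loop (`κ = stepFn`): a diffeotopy
of `S²` with `D_t = id` for `t ≤ 0` and for `t ≥ 1`. [folklore] -/
def basedLoop (hψs : ContMDiff (𝓡 3) (𝓡 3) ∞ ψ) (hψinvs : ContMDiff (𝓡 3) (𝓡 3) ∞ ψinv)
    (hψ : ∀ z, uS (ψ z) = uS z) (hψinv : ∀ z, uS (ψinv z) = uS z)
    (h₁ : ∀ z, ψinv (ψ z) = z) (h₂ : ∀ z, ψ (ψinv z) = z) : Diffeotopy (𝓡 2) (𝕊 2) :=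
  Diffeotopy.mk' (𝓡 2) (loopF ψ ψinv) (loopG ψ ψinv) (contMDiff_loopF ψ ψinv hψs hψinvs)
    (contMDiff_loopG ψ ψinv hψs hψinvs) (loopG_loopF hψ hψinv h₁ h₂) (loopF_loopG hψ hψinv h₁ h₂)
    (loopF_of_le hψinv h₂ (by norm_num))

/-- Stages of the based loop (definitional). [folklore] -/
theorem basedLoop_toFun (hψs : ContMDiff (𝓡 3) (𝓡 3) ∞ ψ) (hψinvs : ContMDiff (𝓡 3) (𝓡 3) ∞ ψinv)
    (hψ : ∀ z, uS (ψ z) = uS z) (hψinv : ∀ z, uS (ψinv z) = uS z)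
    (h₁ : ∀ z, ψinv (ψ z) = z) (h₂ : ∀ z, ψ (ψinv z) = z) :
    (basedLoop hψs hψinvs hψ hψinv h₁ h₂).toFun = loopF ψ ψinv := rfl

/-- The based loop is the identity for `t ≤ 0`. [folklore] -/
theorem basedLoop_of_le (hψs : ContMDiff (𝓡 3) (𝓡 3) ∞ ψ) (hψinvs : ContMDiff (𝓡 3) (𝓡 3) ∞ ψinv)
    (hψ : ∀ z, uS (ψ z) = uS z) (hψinv : ∀ z, uS (ψinv z) = uS z)
    (h₁ : ∀ z, ψinv (ψ z) = z) (h₂ : ∀ z, ψ (ψinv z) = z) (t : ℝ) (ht : t ≤ 0) :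
    (basedLoop hψs hψinvs hψ hψinv h₁ h₂).toFun t = id := by
  rw [basedLoop_toFun]
  exact loopF_of_le hψinv h₂ (by linarith)

/-- The based loop is the identity for `1 ≤ t`. [folklore] -/
theorem basedLoop_of_ge (hψs : ContMDiff (𝓡 3) (𝓡 3) ∞ ψ) (hψinvs : ContMDiff (𝓡 3) (𝓡 3) ∞ ψinv)
    (hψ : ∀ z, uS (ψ z) = uS z) (hψinv : ∀ z, uS (ψinv z) = uS z)
    (h₁ : ∀ z, ψinv (ψ z) = z) (h₂ : ∀ z, ψ (ψinv z) = z) (t : ℝ) (ht : 1 ≤ t) :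
    (basedLoop hψs hψinvs hψ hψinv h₁ h₂).toFun t = id := by
  rw [basedLoop_toFun]
  exact loopF_of_ge hψinv h₂ (by linarith)

end FibreLoop

/-! ### §3 Two smoothness lemmas for the deformations -/

section Deformations

/-- **Cerf's deformation applied fibrewise is a smooth family on the level torus data**: for a
jointly smooth two-parameter family `E σ t` of self-maps of `S²` with `E σ 0 = E σ 1`, the family
`(σ, v, w) ↦ E σ (κ (angA v)) w` is smooth on `ℝ × S¹ × S²` (`contMDiff_stepFamily` with the
parameter `σ` carried along). [folklore] -/
theorem contMDiff_deformFamily {E : ℝ → ℝ → (𝕊 2) → (𝕊 2)}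
    (hE : ContMDiff (𝓘(ℝ, ℝ).prod (𝓘(ℝ, ℝ).prod (𝓡 2))) (𝓡 2) ∞
      fun p : ℝ × (ℝ × (𝕊 2)) => E p.1 p.2.1 p.2.2)
    (h01 : ∀ σ w, E σ 0 w = E σ 1 w) :
    ContMDiff (𝓘(ℝ, ℝ).prod ((𝓡 1).prod (𝓡 2))) (𝓡 2) ∞
      fun p : ℝ × ((𝕊 1) × (𝕊 2)) => E p.1 (stepFn (angA p.2.1)) p.2.2 := by
  -- `G t (σ, w) = E σ t w`
  have hG : ContMDiff (𝓘(ℝ, ℝ).prod (𝓘(ℝ, ℝ).prod (𝓡 2))) (𝓡 2) ∞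
      (uncurry fun (t : ℝ) (p : ℝ × (𝕊 2)) => E p.1 t p.2) := by
    have h := hE.comp (f := fun q : ℝ × (ℝ × (𝕊 2)) => (q.2.1, (q.1, q.2.2)))
      ((contMDiff_fst.comp contMDiff_snd).prodMk (contMDiff_fst.prodMk (contMDiff_snd.comp contMDiff_snd)))
    exact h
  have hG01 : (fun (p : ℝ × (𝕊 2)) => E p.1 0 p.2) = fun p => E p.1 1 p.2 := funext fun p => h01 p.1 p.2
  have h := contMDiff_stepFamily (JY := 𝓘(ℝ, ℝ).prod (𝓡 2)) (Y := ℝ × (𝕊 2)) isCutStep_stepFn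
    (G := fun (t : ℝ) (p : ℝ × (𝕊 2)) => E p.1 t p.2) hG hG01
  have h2 := h.comp (f := fun p : ℝ × ((𝕊 1) × (𝕊 2)) => (p.2.1, (p.1, p.2.2)))
    ((contMDiff_fst.comp contMDiff_snd).prodMk (contMDiff_fst.prodMk (contMDiff_snd.comp contMDiff_snd)))
  exact h2

/-- **A based loop of linear isometries read around the circle through the cut is a smooth family
of continuous linear maps** (`contMDiff_stepFamily'`). [folklore] -/
theorem contMDiff_rotFamily {A : ℝ → (𝔼 3 ≃ₗᵢ[ℝ] 𝔼 3)}
    (hAs : ContDiff ℝ ∞ fun t => (A t : 𝔼 3 →L[ℝ] 𝔼 3)) (hA01 : A 0 = A 1) :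
    ContMDiff (𝓡 1) 𝓘(ℝ, 𝔼 3 →L[ℝ] 𝔼 3) ∞ fun v : 𝕊 1 => (A (stepFn (angA v)) : 𝔼 3 →L[ℝ] 𝔼 3) :=
  contMDiff_stepFamily' isCutStep_stepFn (G := fun t => (A t : 𝔼 3 →L[ℝ] 𝔼 3)) hAs.contMDiff
    (by rw [hA01])

/-- The same for the inverse isometries. [folklore] -/
theorem contMDiff_rotFamily_symm {A : ℝ → (𝔼 3 ≃ₗᵢ[ℝ] 𝔼 3)}
    (hAs : ContDiff ℝ ∞ fun t => (A t : 𝔼 3 →L[ℝ] 𝔼 3)) (hA01 : A 0 = A 1) :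
    ContMDiff (𝓡 1) 𝓘(ℝ, 𝔼 3 →L[ℝ] 𝔼 3) ∞
      fun v : 𝕊 1 => ((A (stepFn (angA v))).symm : 𝔼 3 →L[ℝ] 𝔼 3) :=
  contMDiff_stepFamily' isCutStep_stepFn (G := fun t => ((A t).symm : 𝔼 3 →L[ℝ] 𝔼 3))
    (contDiff_symm_family hAs).contMDiff (by rw [hA01])

/-- Each stage of a jointly smooth loop is smooth. [folklore] -/
theorem contMDiff_stage {g : ℝ → (𝕊 2) → (𝕊 2)}
    (hg : ContMDiff (𝓘(ℝ, ℝ).prod (𝓡 2)) (𝓡 2) ∞ (uncurry g)) (t : ℝ) :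
    ContMDiff (𝓡 2) (𝓡 2) ∞ (g t) := by
  have h := hg.comp (f := fun w : 𝕊 2 => (t, w)) (contMDiff_const.prodMk contMDiff_id)
  exact h

end Deformations

/-! ### §4 The theorem -/

section Main

variable {X : Type} [TopologicalSpace X] [ChartedSpace (𝔼 4) X] [IsManifold (𝓡 4) ∞ X]

/-- The self-map `ψ = χ ∘ splitL⁻¹` of the level torus defined by a gluing map `χ : ∂W₀ → ∂V₀`.
[folklore] -/
def glueSelf (χ : LevelTorusW ≃ₘ⟮𝓡 3, 𝓡 3⟯ LevelTorus) (z : LevelTorus) : LevelTorus := χ (splitL.symm z)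

/-- Its inverse `splitL ∘ χ⁻¹`. [folklore] -/
def glueSelfInv (χ : LevelTorusW ≃ₘ⟮𝓡 3, 𝓡 3⟯ LevelTorus) (z : LevelTorus) : LevelTorus := splitL (χ.symm z)

variable (χ : LevelTorusW ≃ₘ⟮𝓡 3, 𝓡 3⟯ LevelTorus)

/-- `ψ = χ ∘ splitL⁻¹` is smooth. [folklore] -/
theorem contMDiff_glueSelf : ContMDiff (𝓡 3) (𝓡 3) ∞ (glueSelf χ) :=
  χ.contMDiff.comp splitL.symm.contMDiff

/-- `splitL ∘ χ⁻¹` is smooth. [folklore] -/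
theorem contMDiff_glueSelfInv : ContMDiff (𝓡 3) (𝓡 3) ∞ (glueSelfInv χ) :=
  splitL.contMDiff.comp χ.symm.contMDiff

/-- `glueSelfInv χ` is a left inverse of `glueSelf χ`. [folklore] -/
@[simp] theorem glueSelfInv_glueSelf (z : LevelTorus) : glueSelfInv χ (glueSelf χ z) = z := by
  simp [glueSelf, glueSelfInv]

/-- `glueSelfInv χ` is a right inverse of `glueSelf χ`. [folklore] -/
@[simp] theorem glueSelf_glueSelfInv (z : LevelTorus) : glueSelf χ (glueSelfInv χ z) = z := by
  simp [glueSelf, glueSelfInv]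

/-- `ψ (splitL z) = χ z`. [folklore] -/
@[simp] theorem glueSelf_splitL (z : LevelTorusW) : glueSelf χ (splitL z) = χ z := by
  simp [glueSelf]

variable {χ}

/-- A fibred gluing map gives a base-preserving `ψ`. [folklore] -/
theorem uS_glueSelf (hχ : ∀ z, uS (χ z) = uS (splitL z)) (z : LevelTorus) : uS (glueSelf χ z) = uS z := by
  rw [glueSelf, hχ, Diffeomorph.apply_symm_apply]

/-- … and a base-preserving `ψ⁻¹`. [folklore] -/
theorem uS_glueSelfInv (hχ : ∀ z, uS (χ z) = uS (splitL z)) (z : LevelTorus) :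
    uS (glueSelfInv χ z) = uS z := by
  conv_rhs => rw [← glueSelf_glueSelfInv χ z]
  rw [uS_glueSelf hχ]

/-- **4-sphere recognition from a fibred genus-one splitting (no Laudenbach–Poénaru).**  Let the
closed smooth 4-manifold `X` be a gluing `W₀ ∪_χ V₀` of the two tubes of the genus-one splitting
of `S⁴` along a diffeomorphism `χ : ∂W₀ ≅ ∂V₀` of the level torus which preserves the base
coordinate `u = √2 (x₃, x₄) ∈ S¹` (the round-image direction):
`uS (χ z) = uS (splitL z)`, i.e. `χ ∘ splitL⁻¹ (y, θ) = (g_θ y, θ)`.  Then `X ≅ 𝕊⁴`.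
Proof: module docstring (Gluck 1962, §5; Cerf 1968, Appendice §5, Cor. 2 via the tree's
`exists_loopHomotopy_frameLoop_two`; Hirsch 1976, Ch. 8 §2).
[cite: Gluck1962, §5] [cite: CerfDiffeoSphere1968, Appendice §5, Corollaire 2]
[cite: HirschDT1976, Ch. 8 §2, Thms. 2.1–2.3] -/
theorem nonempty_diffeomorph_sphere_four_of_isBoundaryGluing_fibred
    (hX : IsBoundaryGluing bW bV χ (𝓡 4) X)
    (hχ : ∀ z, uS (χ z) = uS (splitL z)) : Nonempty (X ≃ₘ⟮𝓡 4, 𝓡 4⟯ (𝕊 4)) := by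
  /- the fibred self-map `ψ = χ ∘ splitL⁻¹` of the level torus, its fibre loop `g`, the based
    loop `D` and Cerf's deformation `𝒟` of `D` to the loop of rotations `A` -/
  have hψs := contMDiff_glueSelf χ
  have hψinvs := contMDiff_glueSelfInv χ
  have h₁ : ∀ z, glueSelfInv χ (glueSelf χ z) = z := glueSelfInv_glueSelf χ
  have h₂ : ∀ z, glueSelf χ (glueSelfInv χ z) = z := glueSelf_glueSelfInv χ
  have hψu : ∀ z, uS (glueSelf χ z) = uS z := uS_glueSelf hχ
  have hψinvu : ∀ z, uS (glueSelfInv χ z) = uS z := uS_glueSelfInv hχ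
  have hgs : ContMDiff (𝓘(ℝ, ℝ).prod (𝓡 2)) (𝓡 2) ∞ (uncurry (fibreLoop (glueSelf χ))) :=
    contMDiff_fibreLoop _ hψs
  have hginvs : ContMDiff (𝓘(ℝ, ℝ).prod (𝓡 2)) (𝓡 2) ∞ (uncurry (fibreLoop (glueSelfInv χ))) :=
    contMDiff_fibreLoop _ hψinvs
  have hgg : ∀ t w, fibreLoop (glueSelfInv χ) t (fibreLoop (glueSelf χ) t w) = w :=
    fibreLoop_fibreLoop hψu h₁
  have hgg' : ∀ t w, fibreLoop (glueSelf χ) t (fibreLoop (glueSelfInv χ) t w) = w :=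
    fibreLoop_fibreLoop hψinvu h₂
  have hper : ∀ t, fibreLoop (glueSelf χ) (t + 1) = fibreLoop (glueSelf χ) t := fibreLoop_add_one _
  have hperinv : ∀ t, fibreLoop (glueSelfInv χ) (t + 1) = fibreLoop (glueSelfInv χ) t :=
    fibreLoop_add_one _
  have hg0s : ContMDiff (𝓡 2) (𝓡 2) ∞ (fibreLoop (glueSelf χ) 0) := contMDiff_stage hgs 0
  have hginv0s : ContMDiff (𝓡 2) (𝓡 2) ∞ (fibreLoop (glueSelfInv χ) 0) := contMDiff_stage hginvs 0
  obtain ⟨v₀⟩ : Nonempty (𝕊 2) := ⟨⟨EuclideanSpace.single 0 1, by simp⟩⟩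
  obtain ⟨A, 𝒟, 𝒟inv, hAs, hAends, -, h𝒟s, h𝒟invs, h𝒟𝒟, h𝒟𝒟', h𝒟one, h𝒟zero, h𝒟ends⟩ :=
    exists_loopHomotopy_frameLoop_two (basedLoop hψs hψinvs hψu hψinvu h₁ h₂) v₀
      (basedLoop_of_le hψs hψinvs hψu hψinvu h₁ h₂) (basedLoop_of_ge hψs hψinvs hψu hψinvu h₁ h₂)
  have hD_toFun : ∀ t w, (basedLoop hψs hψinvs hψu hψinvu h₁ h₂).toFun t w =
      fibreLoop (glueSelf χ) (stepFn t) (fibreLoop (glueSelfInv χ) 0 w) := fun t w => rfl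
  have h𝒟invends : ∀ σ t, t ≤ 0 ∨ 1 ≤ t → ∀ x, 𝒟inv σ t x = x := by
    intro σ t ht x
    conv_lhs => rw [← h𝒟ends σ t ht x]
    rw [h𝒟𝒟]
  have hA01 : A 0 = A 1 := by rw [hAends 0 (Or.inl le_rfl), hAends 1 (Or.inr le_rfl)]
  /- Step 1: `χ ≃ (y, θ) ↦ (g (κ (κ θ)) y, θ)` by reparametrising the loop (`κ = stepFn`) -/
  have hI1 : IsSmoothlyIsotopic (𝓡 3) (𝓡 3)
      (fibrewiseFun (fun v w => fibreLoop (glueSelf χ)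
        ((1 - 0) * angA v + 0 * (stepFn ∘ stepFn) (angA v)) w) ∘ splitL)
      (fibrewiseFun (fun v w => fibreLoop (glueSelf χ)
        ((1 - 1) * angA v + 1 * (stepFn ∘ stepFn) (angA v)) w) ∘ splitL) :=
    isSmoothlyIsotopic_fibrewise
      (fun s v w => fibreLoop (glueSelf χ) ((1 - s) * angA v + s * (stepFn ∘ stepFn) (angA v)) w)
      (fun s v w => fibreLoop (glueSelfInv χ) ((1 - s) * angA v + s * (stepFn ∘ stepFn) (angA v)) w)
      (contMDiff_reparamFamily isCutStep_stepFn_stepFn hgs hper)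
      (contMDiff_reparamFamily isCutStep_stepFn_stepFn hginvs hperinv)
      (fun s v w => hgg _ w) (fun s v w => hgg' _ w)
  have hΛ0 : fibrewiseFun (fun v w => fibreLoop (glueSelf χ)
      ((1 - 0) * angA v + 0 * (stepFn ∘ stepFn) (angA v)) w) ∘ splitL = ⇑χ := by
    funext z
    rw [comp_apply]
    have h1 : fibrewiseFun (fun v w => fibreLoop (glueSelf χ)
        ((1 - 0) * angA v + 0 * (stepFn ∘ stepFn) (angA v)) w) (splitL z) =
        fibrewiseFun (fibreMap (glueSelf χ)) (splitL z) := by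
      refine fibrewiseFun_congr (fun v w => ?_) _
      rw [sub_zero, one_mul, zero_mul, add_zero, fibreLoop, circlePt_angA]
    rw [h1, fibrewiseFun_fibreMap hψu, glueSelf_splitL]
  /- Step 2: `(y, θ) ↦ (A(κ θ) g_0 y, θ) ≃ (y, θ) ↦ (g (κ (κ θ)) y, θ)` by Cerf's deformation -/
  have hΨs : ContMDiff (𝓘(ℝ, ℝ).prod ((𝓡 1).prod (𝓡 2))) (𝓡 2) ∞
      fun p : ℝ × ((𝕊 1) × (𝕊 2)) => 𝒟 p.1 (stepFn (angA p.2.1)) (fibreLoop (glueSelf χ) 0 p.2.2) := by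
    have hE : ContMDiff (𝓘(ℝ, ℝ).prod (𝓘(ℝ, ℝ).prod (𝓡 2))) (𝓡 2) ∞
        fun p : ℝ × (ℝ × (𝕊 2)) => 𝒟 p.1 p.2.1 (fibreLoop (glueSelf χ) 0 p.2.2) := by
      have h := h𝒟s.comp (f := fun p : ℝ × (ℝ × (𝕊 2)) => (p.1, (p.2.1, fibreLoop (glueSelf χ) 0 p.2.2)))
        (contMDiff_fst.prodMk ((contMDiff_fst.comp contMDiff_snd).prodMk
          (hg0s.comp (contMDiff_snd.comp contMDiff_snd))))
      exact h
    exact contMDiff_deformFamily (E := fun σ t w => 𝒟 σ t (fibreLoop (glueSelf χ) 0 w)) hE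
      fun σ w => by
        show 𝒟 σ 0 (fibreLoop (glueSelf χ) 0 w) = 𝒟 σ 1 (fibreLoop (glueSelf χ) 0 w)
        rw [h𝒟ends σ 0 (Or.inl le_rfl), h𝒟ends σ 1 (Or.inr le_rfl)]
  have hΨinvs : ContMDiff (𝓘(ℝ, ℝ).prod ((𝓡 1).prod (𝓡 2))) (𝓡 2) ∞
      fun p : ℝ × ((𝕊 1) × (𝕊 2)) => fibreLoop (glueSelfInv χ) 0 (𝒟inv p.1 (stepFn (angA p.2.1)) p.2.2) := by
    have hE : ContMDiff (𝓘(ℝ, ℝ).prod (𝓘(ℝ, ℝ).prod (𝓡 2))) (𝓡 2) ∞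
        fun p : ℝ × (ℝ × (𝕊 2)) => fibreLoop (glueSelfInv χ) 0 (𝒟inv p.1 p.2.1 p.2.2) := by
      have h := hginv0s.comp h𝒟invs
      exact h
    exact contMDiff_deformFamily (E := fun σ t w => fibreLoop (glueSelfInv χ) 0 (𝒟inv σ t w)) hE
      fun σ w => by
        show fibreLoop (glueSelfInv χ) 0 (𝒟inv σ 0 w) = fibreLoop (glueSelfInv χ) 0 (𝒟inv σ 1 w)
        rw [h𝒟invends σ 0 (Or.inl le_rfl), h𝒟invends σ 1 (Or.inr le_rfl)]
  have hI2 : IsSmoothlyIsotopic (𝓡 3) (𝓡 3)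
      (fibrewiseFun (fun v w => 𝒟 0 (stepFn (angA v)) (fibreLoop (glueSelf χ) 0 w)) ∘ splitL)
      (fibrewiseFun (fun v w => 𝒟 1 (stepFn (angA v)) (fibreLoop (glueSelf χ) 0 w)) ∘ splitL) :=
    isSmoothlyIsotopic_fibrewise
      (fun σ v w => 𝒟 σ (stepFn (angA v)) (fibreLoop (glueSelf χ) 0 w))
      (fun σ v w => fibreLoop (glueSelfInv χ) 0 (𝒟inv σ (stepFn (angA v)) w)) hΨs hΨinvs
      (fun σ v w => by rw [h𝒟𝒟, hgg]) (fun σ v w => by rw [hgg', h𝒟𝒟'])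
  have hΨ1 : fibrewiseFun (fun v w => 𝒟 1 (stepFn (angA v)) (fibreLoop (glueSelf χ) 0 w)) ∘ splitL =
      fibrewiseFun (fun v w => fibreLoop (glueSelf χ)
        ((1 - 1) * angA v + 1 * (stepFn ∘ stepFn) (angA v)) w) ∘ splitL := by
    funext z
    rw [comp_apply, comp_apply]
    refine fibrewiseFun_congr (fun v w => ?_) _
    rw [h𝒟one, hD_toFun, hgg, sub_self, zero_mul, one_mul, zero_add, comp_apply]
  /- Step 3: the end `(y, θ) ↦ (A(κ θ) g_0 y, θ)` is `∂AV ∘ splitL ∘ ∂BW` -/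
  have hiso : ∀ (v : 𝕊 1) (h : 𝔼 3), ‖(A (stepFn (angA v)) : 𝔼 3 →L[ℝ] 𝔼 3) h‖ = ‖h‖ :=
    fun v h => (A _).norm_map h
  have hiso' : ∀ (v : 𝕊 1) (h : 𝔼 3), ‖((A (stepFn (angA v))).symm : 𝔼 3 →L[ℝ] 𝔼 3) h‖ = ‖h‖ :=
    fun v h => (A _).symm.norm_map h
  have hRR : ∀ (v : 𝕊 1) (h : 𝔼 3),
      ((A (stepFn (angA v))).symm : 𝔼 3 →L[ℝ] 𝔼 3) ((A (stepFn (angA v)) : 𝔼 3 →L[ℝ] 𝔼 3) h) = h :=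
    fun v h => (A _).symm_apply_apply h
  have hRR' : ∀ (v : 𝕊 1) (h : 𝔼 3),
      (A (stepFn (angA v)) : 𝔼 3 →L[ℝ] 𝔼 3) (((A (stepFn (angA v))).symm : 𝔼 3 →L[ℝ] 𝔼 3) h) = h :=
    fun v h => (A _).apply_symm_apply h
  let AV : PolarTube ≃ₘ⟮𝓡∂ 4, 𝓡∂ 4⟯ PolarTube :=
    rotDiffeo (contMDiff_rotFamily hAs hA01) (contMDiff_rotFamily_symm hAs hA01) hiso hiso' hRR hRR'
  let BW : EquatorTube ≃ₘ⟮𝓡∂ 4, 𝓡∂ 4⟯ EquatorTube :=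
    constDiffeo (fibreLoop (glueSelf χ) 0) (fibreLoop (glueSelfInv χ) 0) hg0s hginv0s (hgg 0) (hgg' 0)
  have hS : IsBoundaryGluing bW bV
      ((bW.restrictDiffeomorph bW BW).trans (splitL.trans (bV.restrictDiffeomorph bV AV))) (𝓡 4)
        LevelSphere := isBoundaryGluing_levelSphere_comp AV BW
  have hΨ0 : fibrewiseFun (fun v w => 𝒟 0 (stepFn (angA v)) (fibreLoop (glueSelf χ) 0 w)) ∘ splitL =
      ⇑((bW.restrictDiffeomorph bW BW).trans (splitL.trans (bV.restrictDiffeomorph bV AV))) := by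
    funext z
    rw [comp_apply, Diffeomorph.coe_trans, Diffeomorph.coe_trans, comp_apply, comp_apply]
    have hB : splitL (bW.restrictDiffeomorph bW BW z) =
        fibrewiseFun (fun _ w => fibreLoop (glueSelf χ) 0 w) (splitL z) := by
      have h := restrictDiffeomorph_constDiffeo hg0s hginv0s (hgg 0) (hgg' 0) (splitL z)
      rw [Diffeomorph.symm_apply_apply] at h
      exact h
    rw [hB, restrictDiffeomorph_rotDiffeo, fibrewiseFun_fibrewiseFun]
    refine fibrewiseFun_congr (fun v w => ?_) _
    rw [h𝒟zero]
    rfl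
  /- Step 4: assemble -/
  have hiso_total : IsSmoothlyIsotopic (𝓡 3) (𝓡 3) ⇑χ
      ⇑((bW.restrictDiffeomorph bW BW).trans (splitL.trans (bV.restrictDiffeomorph bV AV))) := by
    rw [← hΛ0, ← hΨ0]
    rw [hΨ1] at hI2
    exact IsSmoothlyIsotopic.trans_holds hI1 hI2.symm
  have hSχ : IsBoundaryGluing bW bV χ (𝓡 4) LevelSphere := hS.of_isSmoothlyIsotopic hiso_total
  obtain ⟨Θ⟩ := nonempty_diffeomorph_of_isBoundaryGluing_holds hX hSχ
  exact ⟨Θ.trans sphereLevelDiffeomorph⟩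

/-- **The same, with the fibredness hypothesis on coordinates**: `χ` preserves the coordinates
`x₃, x₄` of the position in `ℝ⁵`. [cite: Gluck1962, §5] -/
theorem nonempty_diffeomorph_sphere_four_of_isBoundaryGluing_fibred'
    (hX : IsBoundaryGluing bW bV χ (𝓡 4) X)
    (h3 : ∀ z, Xv (χ z) 3 = Xw z 3) (h4 : ∀ z, Xv (χ z) 4 = Xw z 4) :
    Nonempty (X ≃ₘ⟮𝓡 4, 𝓡 4⟯ (𝕊 4)) := by
  refine nonempty_diffeomorph_sphere_four_of_isBoundaryGluing_fibred hX fun z => ?_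
  apply Subtype.ext
  rw [coe_uS, coe_uS]
  refine euclidean_ext fun i => ?_
  fin_cases i
  · show √2 * Xv (χ z) 3 = √2 * Xv (splitL z) 3
    rw [h3, Xv_splitL]
  · show √2 * Xv (χ z) 4 = √2 * Xv (splitL z) 4
    rw [h4, Xv_splitL]

/-- **4-sphere recognition from a fibred genus-one splitting, pieces up to diffeomorphism.**
Let `X = W ∪_φ K` be a gluing of compact pieces with `Ξ : W₀ ≅ W` and `Θ : K ≅ V₀` such that the
transported gluing map `∂Θ ∘ φ ∘ ∂Ξ : ∂W₀ → ∂V₀` preserves the coordinates `x₃, x₄`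
("`Θ` and `Ξ` are fibred over the same base identification on the gluing level").  Then
`X ≅ 𝕊⁴`. [cite: Gluck1962, §5] [cite: HirschDT1976, Ch. 8 §2] -/
theorem nonempty_diffeomorph_sphere_four_of_isBoundaryGluing_of_fibredDiffeomorphs
    {W : Type} [TopologicalSpace W] [ChartedSpace (EuclideanHalfSpace 4) W] [IsManifold (𝓡∂ 4) ∞ W]
    {K : Type} [TopologicalSpace K] [ChartedSpace (EuclideanHalfSpace 4) K] [IsManifold (𝓡∂ 4) ∞ K]
    {bWX : BoundaryData (𝓡∂ 4) W (𝓡 3)} {bK : BoundaryData (𝓡∂ 4) K (𝓡 3)}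
    {φ : bWX.carrier ≃ₘ⟮𝓡 3, 𝓡 3⟯ bK.carrier} (hX : IsBoundaryGluing bWX bK φ (𝓡 4) X)
    (Ξ : EquatorTube ≃ₘ⟮𝓡∂ 4, 𝓡∂ 4⟯ W) (Θ : K ≃ₘ⟮𝓡∂ 4, 𝓡∂ 4⟯ PolarTube)
    (h3 : ∀ z : LevelTorusW,
      Xv (bK.restrictDiffeomorph bV Θ (φ (bW.restrictDiffeomorph bWX Ξ z))) 3 = Xw z 3)
    (h4 : ∀ z : LevelTorusW,
      Xv (bK.restrictDiffeomorph bV Θ (φ (bW.restrictDiffeomorph bWX Ξ z))) 4 = Xw z 4) :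
    Nonempty (X ≃ₘ⟮𝓡 4, 𝓡 4⟯ (𝕊 4)) := by
  -- transport the first piece along `Ξ`
  have h1 : IsBoundaryGluing bW bK ((bW.restrictDiffeomorph bWX Ξ).trans φ) (𝓡 4) X :=
    hX.transfer (b₁ := bW) Ξ
  -- transport the second piece along `Θ`
  have h2 : IsBoundaryGluing bW bV
      (((bW.restrictDiffeomorph bWX Ξ).trans φ).trans (bK.restrictDiffeomorph bV Θ)) (𝓡 4) X := by
    refine IsBoundaryGluing.of_diffeomorph_right (bN := bV) (bN' := bK) h1 Θ.symm fun z => ?_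
    rw [Diffeomorph.coe_trans, comp_apply, BoundaryData.incl_restrictDiffeomorph,
      Diffeomorph.symm_apply_apply]
  exact nonempty_diffeomorph_sphere_four_of_isBoundaryGluing_fibred' h2 h3 h4

end Main

end SphereFourSplitting

end Literature.Topology.FourManifolds
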